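import Summits.KontsevichZagierPeriods.KontsevichZagierPeriods.Theorems.LinRedNormalFormArrangementNormalFormSeparateEngine
import Summits.KontsevichZagierPeriods.KontsevichZagierPeriods.Theorems.LinRedNormalFormArrangementNormalFormStubIntegrateOutMoves

/-!
# The numerator split `GG♮ → GG` (line `janus-bands`, crux `ArrangementNormalForm`)

The last step of the separation for `stub_separatePos` / `stub_separateZero`, with its analytic
content isolated as an explicit hypothesis. A representation of the intermediate class
`GG♮ b k` (`SeparatePos.GNset`: polyhedral base cell × Janus fibres, integrand
`P(x', y)/∏ Lⱼ(x')^{eⱼ} · (y − ℓ(x'))^{−n} · (fibre block)`, the pole non-vanishing on the domain)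
together with a Taylor expansion `P(x', y) = ∑_{i<N} qᵢ(x') (y − ℓ(x'))^i` of its numerator at
the pole is congruent modulo `KZ.relations` to `∑_{i<N} [σ, qᵢ(x')/∏ Lⱼ^{eⱼ} · (y − ℓ)^{i−n} · Φ]`,
a sum of elements of the skeleton class `GG b 1 k` — PROVIDED every term is absolutely
convergent (`hI`): rule (1b), `KZ.of_sub_sum_integrand_mem_relations`.

Main result: `separatePos_split` (registered sub-goal). The hypothesis `hI` (termwise absolute
convergence of the Taylor split) is the remaining analytic crux of the separation: it is NOT
implied by the convergence of `[s]` through domination when `P` vanishes on the closed cell, and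
needs a fibre-mass estimate for Janus fibre blocks.
-/

noncomputable section

open Set MeasureTheory MvPolynomial

namespace Summit.KontsevichZagierPeriods.ArrangementNormalForm.JanusBands

open Literature.NumberTheory.Transcendental Literature.ModelTheory.ExponentialFields

namespace SeparatePos

variable {b k m : ℕ}

/-- Base affine forms in `x'` are semialgebraic. -/
theorem isSemialgebraicFunOn_affB {σ : Set (Fin (b + 1 + k) → ℝ)} (hσ : IsSemialgebraic ℚ σ)
    (c : (Fin b → ℚ) × ℚ) : IsSemialgebraicFunOn ℚ σ (affB b k c) :=
  (isSemialgebraicFunOn_aeval hσ (affPoly b k c)).congr fun z _ => aeval_affPoly c z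

/-- The fibre block is semialgebraic (division with the convention `x / 0 = 0`). -/
theorem isSemialgebraicFunOn_fib {σ : Set (Fin (b + 1 + k) → ℝ)} (hσ : IsSemialgebraic ℚ σ)
    (a : Fin k → Option ((Fin (b + 1) → ℚ) × ℚ)) : IsSemialgebraicFunOn ℚ σ (fib b k a) := by
  unfold fib
  refine IntegrateOut.isSemialgebraicFunOn_finset_prod _ hσ fun i _ => ?_
  cases a i with
  | none => exact (isSemialgebraicFunOn_aeval hσ (C 1)).congr fun z _ => by simp
  | some c =>
    refine (IntegrateOut.isSemialgebraicFunOn_div (isSemialgebraicFunOn_aeval hσ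
      (C 1 : MvPolynomial (Fin (b + 1 + k)) ℚ)) (isSemialgebraicFunOn_aeval hσ
      (X (Fin.natAdd (b + 1) i) - (∑ i', C (c.1 i') * X (Fin.castAdd k i') + C c.2)))).congr
      fun z _ => ?_
    simp [map_sum]

/-- The terms of the numerator split are semialgebraic. -/
theorem isSemialgebraicFunOn_term {σ : Set (Fin (b + 1 + k) → ℝ)} (hσ : IsSemialgebraic ℚ σ)
    (L : Fin m → (Fin b → ℚ) × ℚ) (e : Fin m → ℕ) (q : MvPolynomial (Fin b) ℚ)
    (ℓ : (Fin b → ℚ) × ℚ) (a : Fin k → Option ((Fin (b + 1) → ℚ) × ℚ)) (i n : ℕ) :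
    IsSemialgebraicFunOn ℚ σ (fun z => MvPolynomial.aeval (fun i => z (Fin.castAdd k
      (Fin.castSucc i))) q / (∏ j, (affB b k (L j) z) ^ e j) *
      ((z (Fin.castAdd k (Fin.last b)) - affB b k ℓ z) ^ i /
        (z (Fin.castAdd k (Fin.last b)) - affB b k ℓ z) ^ n) * fib b k a z) := by
  have hq : IsSemialgebraicFunOn ℚ σ (fun z => MvPolynomial.aeval (fun i => z (Fin.castAdd k
      (Fin.castSucc i))) q) :=
    (isSemialgebraicFunOn_aeval hσ (rename (fun i => Fin.castAdd k (Fin.castSucc i)) q)).congr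
      fun z _ => by simp [aeval_rename, Function.comp_def]
  have hu : IsSemialgebraicFunOn ℚ σ (fun z => z (Fin.castAdd k (Fin.last b)) - affB b k ℓ z) :=
    (isSemialgebraicFunOn_aeval hσ (X (Fin.castAdd k (Fin.last b)) - affPoly b k ℓ)).congr
      fun z _ => by simp [aeval_affPoly]
  exact IsSemialgebraicFunOn.mul_holds (IsSemialgebraicFunOn.mul_holds
    (IntegrateOut.isSemialgebraicFunOn_div hq (IntegrateOut.isSemialgebraicFunOn_finset_prod _ hσ
      fun j _ => IntegrateOut.isSemialgebraicFunOn_pow (isSemialgebraicFunOn_affB hσ (L j)) _))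
    (IntegrateOut.isSemialgebraicFunOn_div (IntegrateOut.isSemialgebraicFunOn_pow hu i)
      (IntegrateOut.isSemialgebraicFunOn_pow hu n))) (isSemialgebraicFunOn_fib hσ a)

/-- Cancelling powers of the pole: `u^i / u^n` in `GG` normal form. -/
theorem pow_div_pow_eq {u : ℝ} {i n : ℕ} (h : n ≠ 0 → u ≠ 0) :
    u ^ i / u ^ n = if i < n then u ^ 0 / u ^ (n - i) else u ^ (i - n) / u ^ 0 := by
  rcases Nat.eq_zero_or_pos n with rfl | hn
  · simp
  have hu : u ≠ 0 := h hn.ne'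
  split_ifs with hi
  · rw [pow_zero, div_eq_div_iff (pow_ne_zero _ hu) (pow_ne_zero _ hu), one_mul, ← pow_add,
      Nat.add_sub_of_le hi.le]
  · rw [pow_zero, div_one, pow_sub₀ _ hu (not_lt.mp hi), div_eq_mul_inv]

end SeparatePos

open SeparatePos in
/-- **The numerator split `GG♮ → GG`** (registered sub-goal of `stub_separatePos`). Let `s` be a
representation of the intermediate class `GG♮ b k` (literal data: polyhedral base cell × Janus
fibres; integrand `P(x', y)/∏ Lⱼ(x')^{eⱼ} · (y − ℓ(x'))^{−n} · (fibre block)` with the pole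
non-vanishing on the domain when `n ≠ 0`), and let `P(x', y) = ∑_{i<N} qᵢ(x') (y − ℓ(x'))^i` be a
Taylor expansion of the numerator at the pole (`hq`). If every term
`qᵢ(x')/∏ Lⱼ^{eⱼ} · (y − ℓ)^i/(y − ℓ)^n · Φ` is absolutely convergent on the domain (`hI`), then
`[s]` is congruent modulo `KZ.relations` to a `ℤ`-combination (indeed the sum of the terms) of
elements of `GG b 1 k` (rule 1b, `KZ.of_sub_sum_integrand_mem_relations`; the `i`-th term has
`(n₁, n₂) = (0, n − i)` for `i < n` and `(i − n, 0)` otherwise). -/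
theorem separatePos_split (GG : ℕ → ℕ → ℕ → Set KZ.FormalRep) (hGG : ∀ b σ k, GG b σ k = {w : KZ.FormalRep | ∃ (m m' n₁ n₂ : ℕ) (s : KZ.IntegralRep (b + 1 + k)) (M : Fin m' → (Fin (b + 1) → ℚ) × ℚ) (L : Fin m → (Fin b → ℚ) × ℚ) (e : Fin m → ℕ) (p : MvPolynomial (Fin b) ℚ) (ℓ₁ ℓ₂ : (Fin b → ℚ) × ℚ) (a : Fin k → Option ((Fin (b + 1) → ℚ) × ℚ)) (lo hi : Fin k → Fin k ⊕ ((Fin (b + 1) → ℚ) × ℚ)), (n₁ = 0 ∨ n₂ = 0) ∧ (σ = 2 → (∀ i c, a i = some c → c.1 (Fin.last b) = 0) ∧ (∀ i c, (lo i = Sum.inr c ∨ hi i = Sum.inr c) → (c.1 (Fin.last b) = 0 ∨ c = (Pi.single (Fin.last b) 1, 0)))) ∧ Bornology.IsBounded s.domain ∧ s.domain = {z | (∀ j, 0 < ∑ i, ((M j).1 i : ℝ) * z (Fin.castAdd k i) + ((M j).2 : ℝ)) ∧ ∀ i, Sum.elim (fun j => z (Fin.natAdd (b + 1) j)) (fun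 c => ∑ i', (c.1 i' : ℝ) * z (Fin.castAdd k i') + (c.2 : ℝ)) (lo i) < z (Fin.natAdd (b + 1) i) ∧ z (Fin.natAdd (b + 1) i) < Sum.elim (fun j => z (Fin.natAdd (b + 1) j)) (fun c => ∑ i', (c.1 i' : ℝ) * z (Fin.castAdd k i') + (c.2 : ℝ)) (hi i)} ∧ EqOn s.integrand (fun z => MvPolynomial.aeval (fun i => z (Fin.castAdd k (Fin.castSucc i))) p / (∏ j, (∑ i, ((L j).1 i : ℝ) * z (Fin.castAdd k (Fin.castSucc i)) + ((L j).2 : ℝ)) ^ e j) * ((z (Fin.castAdd k (Fin.last b)) - (∑ i, (ℓ₁.1 i : ℝ) * z (Fin.castAdd k (Fin.castSucc i)) + (ℓ₁.2 : ℝ))) ^ n₁ / (z (Fin.castAdd k (Fin.last b)) - (∑ i, (ℓ₂.1 i : ℝ) * z (Fin.castAdd k (Fin.castSucc i)) + (ℓ₂.2 : ℝ))) ^ n₂) * ∏ i, (a i).elim 1 (fun c => 1 / (z (Fin.natAdd (b + 1) i) - (∑ i', (c.1 i' : ℝ) * z (Fin.castAdd k i') + (c.2 : ℝ))))) s.domain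 ∧ w = KZ.of s}) (b k m m' n : ℕ) (s : KZ.IntegralRep (b + 1 + k)) (M : Fin m' → (Fin (b + 1) → ℚ) × ℚ) (L : Fin m → (Fin b → ℚ) × ℚ) (e : Fin m → ℕ) (p : MvPolynomial (Fin (b + 1)) ℚ) (ℓ : (Fin b → ℚ) × ℚ) (a : Fin k → Option ((Fin (b + 1) → ℚ) × ℚ)) (lo hi : Fin k → Fin k ⊕ ((Fin (b + 1) → ℚ) × ℚ)) (hpole : n ≠ 0 → ∀ z ∈ s.domain, (z (Fin.castAdd k (Fin.last b)) - (∑ i, (ℓ.1 i : ℝ) * z (Fin.castAdd k (Fin.castSucc i)) + (ℓ.2 : ℝ))) ≠ 0) (hbd : Bornology.IsBounded s.domain) (hdom : s.domain = {z | (∀ j, 0 < ∑ i, ((M j).1 i : ℝ) * z (Fin.castAdd k i) + ((M j).2 : ℝ)) ∧ ∀ i, Sum.elim (fun j => z (Fin.natAdd (b + 1) j)) (fun c => ∑ i', (c.1 i' : ℝ) * z (Fin.castAdd k i') + (c.2 : ℝ)) (lo i) < z (Fin.natAdd (b + 1) i) ∧ z (Fin.natAdd (b + 1) i) < Sum.elim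 (fun j => z (Fin.natAdd (b + 1) j)) (fun c => ∑ i', (c.1 i' : ℝ) * z (Fin.castAdd k i') + (c.2 : ℝ)) (hi i)}) (hint : EqOn s.integrand (fun z => MvPolynomial.aeval (fun i => z (Fin.castAdd k i)) p / (∏ j, (∑ i, ((L j).1 i : ℝ) * z (Fin.castAdd k (Fin.castSucc i)) + ((L j).2 : ℝ)) ^ e j) * (1 / (z (Fin.castAdd k (Fin.last b)) - (∑ i, (ℓ.1 i : ℝ) * z (Fin.castAdd k (Fin.castSucc i)) + (ℓ.2 : ℝ))) ^ n) * ∏ i, (a i).elim 1 (fun c => 1 / (z (Fin.natAdd (b + 1) i) - (∑ i', (c.1 i' : ℝ) * z (Fin.castAdd k i') + (c.2 : ℝ))))) s.domain) (N : ℕ) (q : ℕ → MvPolynomial (Fin b) ℚ) (hq : ∀ z : Fin (b + 1 + k) → ℝ, MvPolynomial.aeval (fun i => z (Fin.castAdd k i)) p = ∑ i ∈ Finset.range N, MvPolynomial.aeval (fun i => z (Fin.castAdd k (Fin.castSucc i))) (q i) * (z (Fin.castAdd k (Fin.last b)) - (∑ i, (ℓ.1 i : ℝ) * z (Fin.castAdd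 k (Fin.castSucc i)) + (ℓ.2 : ℝ))) ^ i) (hI : ∀ i ∈ Finset.range N, IntegrableOn (fun z => MvPolynomial.aeval (fun i => z (Fin.castAdd k (Fin.castSucc i))) (q i) / (∏ j, (∑ i, ((L j).1 i : ℝ) * z (Fin.castAdd k (Fin.castSucc i)) + ((L j).2 : ℝ)) ^ e j) * ((z (Fin.castAdd k (Fin.last b)) - (∑ i, (ℓ.1 i : ℝ) * z (Fin.castAdd k (Fin.castSucc i)) + (ℓ.2 : ℝ))) ^ i / (z (Fin.castAdd k (Fin.last b)) - (∑ i, (ℓ.1 i : ℝ) * z (Fin.castAdd k (Fin.castSucc i)) + (ℓ.2 : ℝ))) ^ n) * ∏ i, (a i).elim 1 (fun c => 1 / (z (Fin.natAdd (b + 1) i) - (∑ i', (c.1 i' : ℝ) * z (Fin.castAdd k i') + (c.2 : ℝ))))) s.domain) : ∃ c ∈ AddSubgroup.closure (GG b 1 k), KZ.of s - c ∈ KZ.relations := by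
  have hG1 : GG b 1 k = GGset b 1 k := hGG b 1 k
  rw [hG1]
  have hσ := s.isSemialgebraic_domain
  set g : Fin N → (Fin (b + 1 + k) → ℝ) → ℝ := fun i z => MvPolynomial.aeval (fun i => z
    (Fin.castAdd k (Fin.castSucc i))) (q i) / (∏ j, (affB b k (L j) z) ^ e j) *
    ((z (Fin.castAdd k (Fin.last b)) - affB b k ℓ z) ^ (i : ℕ) /
      (z (Fin.castAdd k (Fin.last b)) - affB b k ℓ z) ^ n) * fib b k a z with hg
  have hsa : ∀ i, IsSemialgebraicFunOn ℚ s.domain (g i) := fun i =>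
    isSemialgebraicFunOn_term hσ L e (q i) ℓ a i n
  set R : Fin N → KZ.IntegralRep (b + 1 + k) := fun i =>
    ⟨s.domain, g i, hσ, hsa i, hI i (Finset.mem_range.2 i.isLt)⟩ with hR
  have hrel : KZ.of s - ∑ i, KZ.of (R i) ∈ KZ.relations := by
    refine KZ.of_sub_sum_integrand_mem_relations Finset.univ R s (fun i _ => rfl) fun z hz => ?_
    rw [hint hz]
    show MvPolynomial.aeval (fun i => z (Fin.castAdd k i)) p / (∏ j, (affB b k (L j) z) ^ e j) *
      (1 / (z (Fin.castAdd k (Fin.last b)) - affB b k ℓ z) ^ n) * fib b k a z = ∑ i, g i z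
    rw [hq z, ← Fin.sum_univ_eq_sum_range, Finset.sum_div, Finset.sum_mul, Finset.sum_mul]
    refine Finset.sum_congr rfl fun i _ => ?_
    simp only [hg, affB]
    ring
  have hmem : ∀ i, KZ.of (R i) ∈ GGset b 1 k := fun i => by
    by_cases hin : (i : ℕ) < n
    · refine ⟨m, m', 0, n - i, R i, M, L, e, q i, ℓ, ℓ, a, lo, hi, Or.inl rfl,
        fun h => absurd h (by decide), hbd, hdom, fun z hz => ?_, rfl⟩
      show g i z = _
      simp only [hg, affB, fib, pow_div_pow_eq (hpole · z hz), if_pos hin]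
    · refine ⟨m, m', i - n, 0, R i, M, L, e, q i, ℓ, ℓ, a, lo, hi, Or.inr rfl,
        fun h => absurd h (by decide), hbd, hdom, fun z hz => ?_, rfl⟩
      show g i z = _
      simp only [hg, affB, fib, pow_div_pow_eq (hpole · z hz), if_neg hin]
  exact ⟨∑ i, KZ.of (R i), AddSubgroup.sum_mem _ fun i _ => AddSubgroup.subset_closure (hmem i),
    hrel⟩

end Summit.KontsevichZagierPeriods.ArrangementNormalForm.JanusBands
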